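import Literature.Geometry.Kaehler.LimitConeChain
import Literature.Geometry.Kaehler.HolomorphicChainNormalChart

/-!
# Holomorphic charts of the limit cone at its regular points of dimension `p`

The **unit tangent-cone chain** `limitConeUnitChain hA hb = limitConeChain hA hb 1` (all conic
components of the limit cone `F` of `A` at `b` with multiplicity `1`) has support `cl M` and its
carrier contains the regular part `M = limitConeReg A hb p` of `F` (`mem_carrier_limitConeUnitChain`:
near a point of `M`, `F`, `cl M` and the component all coincide). Hence the normalised holomorphic
charts of holomorphic chains (`HolomorphicChain.exists_normalChart`) are available at every point of
`M` (`exists_limitConeChart`): a complex `p`-plane `K` (the tangent plane), a linear projection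
`π₁` onto `K`, and a holomorphic graph parametrisation `Ψ` of `F` near the point — the charts over
which the windows of the collapse homotopy are built (King's tangent cone theorem).

Definitions with bodies + theorems; no named facts.

## References

* E. M. Chirka, *Complex Analytic Sets*, Kluwer 1989, §2.3, §8.1 [Chirka1989].
* R. Harvey, *Holomorphic chains and their boundaries*, PSPUM XXX.1 (1977), §1.4, §1.10 [Harvey1977].
-/

open scoped Manifold Topology ENNReal
open Set Filter Function TopologicalSpace Metric MeasureTheory Module

namespace Literature.Geometry.Kaehler

universe u

variable {V : Type u} [NormedAddCommGroup V] [InnerProductSpace ℂ V] [FiniteDimensional ℂ V]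
  {Ω : Opens V} {A : Set Ω} {b : V} {p : ℕ}

/-- **The unit tangent-cone chain**: every conic component with multiplicity `1`.
[cite: Harvey1977, §1.10] -/
noncomputable def limitConeUnitChain (hA : HasPureDim 𝓘(ℂ, V) A p) (hb : b ∈ (Ω : Set V)) :
    HolomorphicChain 𝓘(ℂ, V) (⊤ : Opens V) p :=
  limitConeChain hA hb fun _ => 1

/-- The support of the unit tangent-cone chain: the union of all conic components. [folklore] -/
theorem mem_support_limitConeUnitChain_iff (hA : HasPureDim 𝓘(ℂ, V) A p) (hb : b ∈ (Ω : Set V))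
    {x : (⊤ : Opens V)} :
    x ∈ (limitConeUnitChain hA hb).support ↔ ∃ y ∈ limitConeReg A hb p, x ∈ limitConeIrr A hb y := by
  rw [limitConeUnitChain, mem_support_limitConeChain_iff]
  simp

/-- `M ⊆ |C₁|`. [folklore] -/
theorem limitConeReg_subset_support_limitConeUnitChain (hA : HasPureDim 𝓘(ℂ, V) A p)
    (hb : b ∈ (Ω : Set V)) : limitConeReg A hb p ⊆ (limitConeUnitChain hA hb).support := fun y hy =>
  (mem_support_limitConeUnitChain_iff hA hb).2 ⟨y, hy, subset_closure (mem_limitConeComp_self hy)⟩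

/-- `|C₁| ⊆ F`. [folklore] -/
theorem support_limitConeUnitChain_subset (hA : HasPureDim 𝓘(ℂ, V) A p) (hb : b ∈ (Ω : Set V)) :
    (limitConeUnitChain hA hb).support ⊆ limitConeTop A hb :=
  support_limitConeChain_subset hA hb _

/-- **Near a point of `M`, the support of the unit chain is the limit cone** (both agree with the
component through the point). [cite: Chirka1989, §5.3] -/
theorem exists_isOpen_support_limitConeUnitChain_inter_eq (hA : HasPureDim 𝓘(ℂ, V) A p)
    (hb : b ∈ (Ω : Set V)) {y : (⊤ : Opens V)} (hy : y ∈ limitConeReg A hb p) :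
    ∃ N : Set (⊤ : Opens V), IsOpen N ∧ y ∈ N ∧
      (limitConeUnitChain hA hb).support ∩ N = limitConeTop A hb ∩ N := by
  obtain ⟨N, hNo, hyN, hFN⟩ := exists_isOpen_limitConeTop_inter_eq (mem_limitConeComp_self hy)
  refine ⟨N, hNo, hyN, Subset.antisymm
    (inter_subset_inter_left _ (support_limitConeUnitChain_subset hA hb)) ?_⟩
  rw [hFN]
  rintro x ⟨hx, hxN⟩
  exact ⟨(mem_support_limitConeUnitChain_iff hA hb).2 ⟨y, hy, subset_closure hx⟩, hxN⟩

/-- **Points of `M` are regular points of the support of the unit chain**, of codimension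
`dim V − p`. [cite: Chirka1989, §2.3] -/
theorem isRegularPointOfCodim_support_limitConeUnitChain (hA : HasPureDim 𝓘(ℂ, V) A p)
    (hb : b ∈ (Ω : Set V)) {y : (⊤ : Opens V)} (hy : y ∈ limitConeReg A hb p) :
    IsRegularPointOfCodim 𝓘(ℂ, V) (limitConeUnitChain hA hb).support (finrank ℂ V - p) y := by
  obtain ⟨N, hNo, hyN, hSN⟩ := exists_isOpen_support_limitConeUnitChain_inter_eq hA hb hy
  exact (mem_limitConeReg_iff.1 hy).2.congr_set hNo hyN hSN.symm

/-- **`M` lies in the carrier of the unit tangent-cone chain.** [cite: Chirka1989, §14.1 Cor.] -/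
theorem mem_carrier_limitConeUnitChain [MeasurableSpace V] [BorelSpace V]
    (hA : HasPureDim 𝓘(ℂ, V) A p) (hb : b ∈ (Ω : Set V)) {y : (⊤ : Opens V)}
    (hy : y ∈ limitConeReg A hb p) : (y : V) ∈ (limitConeUnitChain hA hb).carrier :=
  ⟨y, ⟨limitConeReg_subset_support_limitConeUnitChain hA hb hy, _,
    isRegularPointOfCodim_support_limitConeUnitChain hA hb hy⟩, rfl⟩

/-- **Holomorphic charts of the limit cone at points of `M`**: the normalised chart of the unit
tangent-cone chain (`HolomorphicChain.exists_normalChart`). There are a complex `p`-plane `K`, a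
continuous linear `π₁ : V → K` with `π₁|_K = id`, `ρ > 0`, an open `N ∋ y` and `Ψ : K → V`
holomorphic on `ball 0 ρ` with `Ψ 0 = y`, `DΨ(0) = ι_K`, `π₁ (Ψ k − y) = k`, `Ψ(ball 0 ρ)` inside the
carrier (hence inside `F`) and the carrier near `y` inside `Ψ(ball 0 ρ)`.
[cite: Chirka1989, §2.3; Harvey1977, §1.4] -/
theorem exists_limitConeChart [MeasurableSpace V] [BorelSpace V] (hA : HasPureDim 𝓘(ℂ, V) A p)
    (hb : b ∈ (Ω : Set V)) {y : (⊤ : Opens V)} (hy : y ∈ limitConeReg A hb p) :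
    ∃ (K : Submodule ℂ V) (π₁ : V →L[ℂ] K) (ρ : ℝ) (Ψ : K → V) (N : Set V),
      finrank ℂ K = p ∧ (∀ k : K, π₁ (k : V) = k) ∧ 0 < ρ ∧ IsOpen N ∧ (y : V) ∈ N ∧
      DifferentiableOn ℂ Ψ (ball 0 ρ) ∧ Ψ 0 = y ∧ fderiv ℂ Ψ 0 = K.subtypeL ∧
      (∀ k ∈ ball (0 : K) ρ, π₁ (Ψ k - y) = k) ∧
      (∀ k ∈ ball (0 : K) ρ, Ψ k ∈ (limitConeUnitChain hA hb).carrier) ∧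
      (limitConeUnitChain hA hb).carrier ∩ N ⊆ Ψ '' ball 0 ρ := by
  obtain ⟨K, π₁, ρ, Ψ, N, hK, hπ, hρ, hNo, hyN, -, hΨd, hΨ0, hDΨ, hπΨ, hΨc, hcN, -, -⟩ :=
    (limitConeUnitChain hA hb).exists_normalChart (mem_carrier_limitConeUnitChain hA hb hy)
  exact ⟨K, π₁, ρ, Ψ, N, hK, hπ, hρ, hNo, hyN, hΨd, hΨ0, hDΨ, hπΨ, hΨc, hcN⟩

/-- The carrier of the unit tangent-cone chain lies in the limit cone. [folklore] -/
theorem carrier_limitConeUnitChain_subset [MeasurableSpace V] [BorelSpace V]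
    (hA : HasPureDim 𝓘(ℂ, V) A p) (hb : b ∈ (Ω : Set V)) :
    (limitConeUnitChain hA hb).carrier ⊆ limitCone A hb := by
  rintro _ ⟨x, hx, rfl⟩
  exact support_limitConeUnitChain_subset hA hb hx.1

end Literature.Geometry.Kaehler
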